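import Literature.NumberTheory.EllipticCurves.TwoDescentOneRootCharacter
import Literature.NumberTheory.EllipticCurves.TwoDescentOneRootAdjoinRoot
import Literature.NumberTheory.EllipticCurves.SelmerTorsionRestriction
import Literature.NumberTheory.EllipticCurves.TwoTorsion
import Literature.Barriers.BirchSwinnertonDyer.DescentDefectUnboundedMatsunoLocalKernelProofs
import Mathlib.FieldTheory.PrimitiveElement
import HarnessLib

/-!
# The cubic `2`-division field inside `k̄`: the point `T_θ ∈ E[2](k̄)`, its stabiliser `Γ_K ≤ Γ_k`,
# and `E(k)[2] = 0` (Galois input of the general `2`-descent, Cassels LMSST 24 §15)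

Sequel of `TwoDescentOneRootCharacter.lean`. Setting: an elliptic curve `E/k` (`char k = 0`), an algebraic extension
`K/k` and a root `θ ∈ K` of the `2`-division cubic; when needed, the monic `2`-division cubic
`x³ + (b₂/4)x² + (b₄/2)x + b₆/4` is IRREDUCIBLE over `k` and `[K : k] = 3` (so `K = k(θ)` is the cubic
`2`-division field, Cassels' `ℚ[Θ]`). On the tree's model of Galois cohomology (`geomPoints`, `geomTorsion`,
`galRange K ≤ Γ_k` the image of `Γ_K`, the coefficient map `torsionBaseChangeMap : E[2](k̄) → E_K[2](K̄)` of
`SelmerTorsionRestriction.lean`):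

* `closureCopy K : K →ₐ[k] k̄` — the copy `j` of `K` in `k̄` given by the chosen embedding `k̄ → K̄`;
  `mem_galRange_iff_forall_closureCopy` — `galRange K` is its pointwise fixer;
* `geomOneRootOver hθ : E(k̄)` — the `K`-rational `2`-torsion point `T_θ = (j θ, −(a₁ jθ + a₃)/2)`; it is a non-zero
  element of `E[2]` (`geomOneRootOverTorsion`), and under `torsionBaseChangeMap` it goes to the point `T_θ` of the
  prequel over `K` (`torsionBaseChangeMap_geomOneRootOverTorsion`);
* **`smul_geomOneRootOverTorsion_eq_iff`** — the stabiliser of `T_θ` in `Γ_k` is EXACTLY `galRange K`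
  (`⊇`: `K`-rational coordinates; `⊆`: an automorphism fixing `jθ` fixes `j(k(θ)) = j(K)`, by the primitive element
  theorem `Field.primitive_element_iff_minpoly_natDegree_eq` with `minpoly_k θ = Ψ₂/4`, `minpoly_eq_twoDivision_monic`);
* **`exists_smul_ne_of_irreducible`** — no non-zero point of `E[2](k̄)` is fixed by `Γ_k` (Galois descent
  `fixedPoints_eq_range_map_holds`: a fixed point is `k`-rational and its abscissa a `k`-root of the irreducible cubic);
* `exists_geomTwoTorsion_eq_over` — `E[2](k̄) = {O, T_θ, T₂, T₃}`, `T_θ + T₂ = T₃`.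

Definitions with bodies and theorems; no named fact, no `sorry`. Seat `bsd-line-spt-p1` (g28), input of
`TwoDescentOneRootH1Injective.lean` (injectivity of `H¹(k, E[2]) → H¹(K, μ₂)`).

## References

* [Cassels1991LecturesEllipticCurves] J. W. S. Cassels, *Lectures on Elliptic Curves*, LMSST 24, CUP 1991, §15
  (pp. 42–44: `ℚ[Θ]`, the case of irreducible `F`).
* [SilvermanAEC2009] J. H. Silverman, *The Arithmetic of Elliptic Curves*, 2nd ed., GTM 106 (2009), Prop. III.2.3,
  Cor. III.6.4, VIII.§1 (Galois descent), Prop. X.1.4.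
* [SerreGaloisCohomology1997] J.-P. Serre, *Galois Cohomology*, Springer 1997, I.§2.4, II.§1.1.
-/

noncomputable section

open scoped Classical

universe u

/-! ## The geometry: the cubic `2`-division field inside `k̄` -/

namespace Literature.NumberTheory.EllipticCurves

open Field

section ClosureCopy

variable {k : Type u} [Field k] (K : Type u) [Field K] [Algebra k K] [Algebra.IsAlgebraic k K]

/-- The copy `j : K → k̄` of `K` inside the algebraic closure of `k` singled out by the tree's chosen embedding
`closureEmb K : k̄ → K̄` (`j = (closureEmb)⁻¹ ∘ (K → K̄)`); its pointwise fixer in `Γ_k` is `galRange K`, the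
image of `Γ_K → Γ_k` (`mem_galRange_iff_forall_apply_eq`). [cite: SerreGaloisCohomology1997, II.§1.1] -/
def closureCopy : K →ₐ[k] AlgebraicClosure k :=
  ((algEquivOfEmb K (closureEmb (K := k) K)).symm.toAlgHom).comp
    (IsScalarTower.toAlgHom k K (AlgebraicClosure K))

/-- Unfolding `closureCopy`. [cite: SerreGaloisCohomology1997, II.§1.1] -/
theorem closureCopy_apply (x : K) :
    closureCopy K x = (algEquivOfEmb K (closureEmb (K := k) K)).symm (algebraMap K (AlgebraicClosure K) x) :=
  rfl

/-- `closureEmb ∘ j = (K → K̄)`. [cite: SerreGaloisCohomology1997, II.§1.1] -/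
theorem closureEmb_closureCopy (x : K) :
    closureEmb (K := k) K (closureCopy K x) = algebraMap K (AlgebraicClosure K) x := by
  rw [closureCopy_apply, ← algEquivOfEmb_apply K (closureEmb (K := k) K), AlgEquiv.apply_symm_apply]

/-- `galRange K` is the pointwise fixer of `j(K)` in `Γ_k`. [cite: SerreGaloisCohomology1997, II.§1.1] -/
theorem mem_galRange_iff_forall_closureCopy (g : absoluteGaloisGroup k) :
    g ∈ galRange (K := k) K ↔
      ∀ x : K, (show AlgebraicClosure k ≃ₐ[k] AlgebraicClosure k from g) (closureCopy K x) = closureCopy K x :=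
  Literature.Barriers.BirchSwinnertonDyer.mem_galRange_iff_forall_apply_eq K g

end ClosureCopy

end Literature.NumberTheory.EllipticCurves

namespace WeierstrassCurve

open Literature Literature.NumberTheory.GaloisRepresentations Literature.NumberTheory.EllipticCurves Field
open WeierstrassCurve.Affine Polynomial

variable {k : Type u} [Field k] [CharZero k] (W : WeierstrassCurve k) [W.IsElliptic]
  {K : Type u} [Field K] [Algebra k K] [Algebra.IsAlgebraic k K] {θ : K}

omit [CharZero k] [W.IsElliptic] [Algebra.IsAlgebraic k K] in
/-- A root of `Ψ₂` in `K` goes to a root of `Ψ₂` in `k̄` under any `k`-algebra map `K → k̄`.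
[cite: SilvermanAEC2009, Prop. III.2.3] -/
theorem isTwoTorsionX_algHom (f : K →ₐ[k] AlgebraicClosure k) (hθ : (W.baseChange K).toAffine.IsTwoTorsionX θ) :
    (W.baseChange (AlgebraicClosure k)).toAffine.IsTwoTorsionX (f θ) := by
  refine ⟨?_⟩
  have h' := congrArg f hθ.eq
  simp only [map_add, map_mul, map_pow, map_ofNat, map_zero] at h'
  have hb₂ : f (W.baseChange K).toAffine.b₂ = (W.baseChange (AlgebraicClosure k)).toAffine.b₂ := by
    change f (W.map (algebraMap k K)).b₂ = (W.map (algebraMap k (AlgebraicClosure k))).b₂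
    rw [map_b₂, map_b₂, AlgHom.commutes]
  have hb₄ : f (W.baseChange K).toAffine.b₄ = (W.baseChange (AlgebraicClosure k)).toAffine.b₄ := by
    change f (W.map (algebraMap k K)).b₄ = (W.map (algebraMap k (AlgebraicClosure k))).b₄
    rw [map_b₄, map_b₄, AlgHom.commutes]
  have hb₆ : f (W.baseChange K).toAffine.b₆ = (W.baseChange (AlgebraicClosure k)).toAffine.b₆ := by
    change f (W.map (algebraMap k K)).b₆ = (W.map (algebraMap k (AlgebraicClosure k))).b₆
    rw [map_b₆, map_b₆, AlgHom.commutes]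
  rw [hb₂, hb₄, hb₆] at h'
  exact h'

/-- `T_θ` is a nonsingular point of `E/k̄` (coordinates `j(θ)`, `−(a₁ j(θ) + a₃)/2`). [cite: SilvermanAEC2009, Prop. III.2.3] -/
theorem nonsingular_geomOneRootOver (hθ : (W.baseChange K).toAffine.IsTwoTorsionX θ) :
    (W.baseChange (AlgebraicClosure k)).toAffine.Nonsingular (closureCopy K θ)
      ((W.baseChange (AlgebraicClosure k)).toAffine.twoTorsionY (closureCopy K θ)) := by
  haveI := W.isElliptic_baseChange (AlgebraicClosure k)
  exact (W.isTwoTorsionX_algHom (closureCopy K) hθ).nonsingular_twoTorsion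

/-- **The `K`-rational `2`-torsion point `T_θ` as a point of `E(k̄)`** (through the copy `j(K) ⊂ k̄`).
[cite: Cassels1991LecturesEllipticCurves, §15 (the root θ)] -/
def geomOneRootOver (hθ : (W.baseChange K).toAffine.IsTwoTorsionX θ) : geomPoints W :=
  Affine.Point.some _ _ (W.nonsingular_geomOneRootOver hθ)

/-- `T_θ ∈ E[2]`. [cite: SilvermanAEC2009, Prop. III.2.3] -/
theorem geomOneRootOver_mem (hθ : (W.baseChange K).toAffine.IsTwoTorsionX θ) :
    W.geomOneRootOver hθ ∈ geomTorsion W 2 := by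
  rw [mem_geomTorsion_iff, two_zsmul]
  exact Affine.Point.add_self_of_Y_eq (Affine.negY_twoTorsionY _).symm

/-- `T_θ ≠ O`. [cite: SilvermanAEC2009, Prop. III.2.3] -/
theorem geomOneRootOver_ne_zero (hθ : (W.baseChange K).toAffine.IsTwoTorsionX θ) :
    W.geomOneRootOver hθ ≠ 0 :=
  Affine.Point.some_ne_zero _

/-- `T_θ` as an element of the `Γ_k`-module `E[2]`. [cite: SilvermanAEC2009, Prop. X.1.4] -/
def geomOneRootOverTorsion (hθ : (W.baseChange K).toAffine.IsTwoTorsionX θ) : geomTorsion W 2 :=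
  ⟨W.geomOneRootOver hθ, W.geomOneRootOver_mem hθ⟩

/-- The action of `g ∈ Γ_k` on `T_θ`: `g • T_θ = T_θ ↔ g(j θ) = j θ`. [cite: SilvermanAEC2009, VIII.§1] -/
theorem smul_geomOneRootOver_eq_iff (hθ : (W.baseChange K).toAffine.IsTwoTorsionX θ) (g : absoluteGaloisGroup k) :
    g • W.geomOneRootOver hθ = W.geomOneRootOver hθ ↔
      (show AlgebraicClosure k ≃ₐ[k] AlgebraicClosure k from g) (closureCopy K θ) = closureCopy K θ := by
  set τ : AlgebraicClosure k ≃ₐ[k] AlgebraicClosure k := g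
  change Affine.Point.map (W' := W) (τ : AlgebraicClosure k →ₐ[k] AlgebraicClosure k)
    (W.geomOneRootOver hθ) = W.geomOneRootOver hθ ↔ _
  unfold geomOneRootOver
  rw [Affine.Point.map_some]
  simp only [Affine.Point.some.injEq, AlgEquiv.coe_toAlgHom]
  constructor
  · exact fun h => h.1
  · intro h
    refine ⟨h, ?_⟩
    simp only [twoTorsionY, baseChange, map_a₁, map_a₃, map_neg, map_div₀, map_add, map_mul,
      map_ofNat, AlgEquiv.commutes, h]

/-! ### `T_θ` over `k̄` versus `T_θ` over `K̄`: the restriction of coefficients -/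

/-- **Under the coefficient map `E[2](k̄) → E_K[2](K̄)` of the tree's restriction, `T_θ ↦ T_θ`.**
[cite: SerreGaloisCohomology1997, I.§2.4 (compatible pairs)] -/
theorem torsionBaseChangeMap_geomOneRootOverTorsion [CharZero K] [(W.baseChange K).IsElliptic]
    (hθ : (W.baseChange K).toAffine.IsTwoTorsionX θ) :
    ((torsionBaseChangeMap W K 2 (W.geomOneRootOverTorsion hθ) : geomTorsion (W.baseChange K) 2) :
        geomPoints (W.baseChange K)) = (W.baseChange K).geomOneRoot hθ := by
  rw [coe_torsionBaseChangeMap]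
  change localPointsEquivGeomPoints W K
    (Affine.Point.map (W' := W) (closureEmb (K := k) K) (W.geomOneRootOver hθ)) = _
  unfold geomOneRootOver
  rw [Affine.Point.map_some]
  change pointsCongr W K (AlgebraicClosure K) _ = _
  unfold pointsCongr
  rw [Affine.Point.congrEquiv_some, (W.baseChange K).some_eq_geomOneRoot_iff hθ]
  exact closureEmb_closureCopy K θ

/-! ### The stabiliser of `T_θ` is `galRange K` -/

omit [CharZero k] [W.IsElliptic] [Algebra.IsAlgebraic k K] in
/-- `θ` is a root of the monic `2`-division cubic `x³ + (b₂/4)x² + (b₄/2)x + b₆/4 ∈ k[X]`.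
[cite: Cassels1991LecturesEllipticCurves, §15 (F(Θ) = 0)] -/
theorem aeval_twoDivision_monic_eq_zero [CharZero K] (hθ : (W.baseChange K).toAffine.IsTwoTorsionX θ) :
    aeval θ (X ^ 3 + C (W.b₂ / 4) * X ^ 2 + C (W.b₄ / 2) * X + C (W.b₆ / 4) : k[X]) = 0 := by
  have h := hθ.eq
  have hb2 : (W.baseChange K).toAffine.b₂ = algebraMap k K W.b₂ := W.map_b₂ _
  have hb4 : (W.baseChange K).toAffine.b₄ = algebraMap k K W.b₄ := W.map_b₄ _
  have hb6 : (W.baseChange K).toAffine.b₆ = algebraMap k K W.b₆ := W.map_b₆ _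
  rw [hb2, hb4, hb6] at h
  simp only [map_add, map_mul, map_pow, aeval_X, aeval_C, map_div₀]
  have h4 : (algebraMap k K) 4 = 4 := map_ofNat _ 4
  have h2 : (algebraMap k K) 2 = 2 := map_ofNat _ 2
  rw [h4, h2]
  linear_combination (1 / 4 : K) * h

omit [CharZero k] [W.IsElliptic] [Algebra.IsAlgebraic k K] in
/-- For `Ψ₂/4` irreducible over `k`, `minpoly_k(θ) = Ψ₂/4`. [cite: Cassels1991LecturesEllipticCurves, §15 (F irreducible)] -/
theorem minpoly_eq_twoDivision_monic [CharZero K]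
    (hirr : Irreducible (X ^ 3 + C (W.b₂ / 4) * X ^ 2 + C (W.b₄ / 2) * X + C (W.b₆ / 4) : k[X]))
    (hθ : (W.baseChange K).toAffine.IsTwoTorsionX θ) :
    minpoly k θ = X ^ 3 + C (W.b₂ / 4) * X ^ 2 + C (W.b₄ / 2) * X + C (W.b₆ / 4) :=
  (minpoly.eq_of_irreducible_of_monic hirr (W.aeval_twoDivision_monic_eq_zero hθ)
    (W.monic_twoDivision_monic)).symm

omit [CharZero k] [W.IsElliptic] [Algebra.IsAlgebraic k K] in
/-- **`K = k(θ)`**: with `[K : k] = 3` and `Ψ₂/4` irreducible, `θ` is a primitive element of `K/k`.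
[cite: Cassels1991LecturesEllipticCurves, §15 (ℚ[Θ] a cubic field)] -/
theorem adjoin_root_eq_top [CharZero K]
    (hirr : Irreducible (X ^ 3 + C (W.b₂ / 4) * X ^ 2 + C (W.b₄ / 2) * X + C (W.b₆ / 4) : k[X]))
    (h3 : Module.finrank k K = 3) (hθ : (W.baseChange K).toAffine.IsTwoTorsionX θ) :
    IntermediateField.adjoin k {θ} = ⊤ := by
  haveI : FiniteDimensional k K := Module.finite_of_finrank_eq_succ h3
  rw [Field.primitive_element_iff_minpoly_natDegree_eq, W.minpoly_eq_twoDivision_monic hirr hθ,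
    natDegree_twoDivision_monic, h3]

omit [CharZero k] [W.IsElliptic] in
/-- An automorphism of `k̄/k` fixing `j(θ)` fixes `j(K)` pointwise (`K = k(θ)`). [cite: SerreGaloisCohomology1997, II.§1.1] -/
theorem forall_apply_closureCopy_eq [CharZero K]
    (hirr : Irreducible (X ^ 3 + C (W.b₂ / 4) * X ^ 2 + C (W.b₄ / 2) * X + C (W.b₆ / 4) : k[X]))
    (h3 : Module.finrank k K = 3) (hθ : (W.baseChange K).toAffine.IsTwoTorsionX θ)
    {g : AlgebraicClosure k ≃ₐ[k] AlgebraicClosure k} (hg : g (closureCopy K θ) = closureCopy K θ) (x : K) :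
    g (closureCopy K x) = closureCopy K x := by
  haveI : FiniteDimensional k K := Module.finite_of_finrank_eq_succ h3
  have halg : _root_.IsAlgebraic k θ := (_root_.IsIntegral.of_finite k θ).isAlgebraic
  have hmem : x ∈ (IntermediateField.adjoin k {θ}).toSubalgebra := by
    rw [W.adjoin_root_eq_top hirr h3 hθ]; trivial
  rw [IntermediateField.adjoin_simple_toSubalgebra_of_isAlgebraic halg] at hmem
  have hle : Algebra.adjoin k {θ} ≤ AlgHom.equalizer ((g : AlgebraicClosure k →ₐ[k] AlgebraicClosure k).comp
      (closureCopy K)) (closureCopy K) := by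
    rw [Algebra.adjoin_le_iff, Set.singleton_subset_iff]
    exact hg
  exact hle hmem

/-- **The stabiliser of `T_θ` in `Γ_k` is `galRange K`**, the image of `Γ_K ↪ Γ_k`.
[cite: SerreGaloisCohomology1997, II.§1.1] [cite: SilvermanAEC2009, VIII.§1] -/
theorem smul_geomOneRootOverTorsion_eq_iff [CharZero K]
    (hirr : Irreducible (X ^ 3 + C (W.b₂ / 4) * X ^ 2 + C (W.b₄ / 2) * X + C (W.b₆ / 4) : k[X]))
    (h3 : Module.finrank k K = 3) (hθ : (W.baseChange K).toAffine.IsTwoTorsionX θ)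
    (g : absoluteGaloisGroup k) :
    g • W.geomOneRootOverTorsion hθ = W.geomOneRootOverTorsion hθ ↔ g ∈ galRange (K := k) K := by
  rw [mem_galRange_iff_forall_closureCopy]
  constructor
  · intro h x
    have h' : g • W.geomOneRootOver hθ = W.geomOneRootOver hθ := by
      have := congrArg (fun P : geomTorsion W 2 => (P : geomPoints W)) h
      simp only [Literature.NumberTheory.EllipticCurves.AddSubgroup.torsionBy.coe_smul] at this
      exact this
    exact W.forall_apply_closureCopy_eq hirr h3 hθ ((W.smul_geomOneRootOver_eq_iff hθ g).mp h') x
  · intro h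
    apply Subtype.ext
    rw [Literature.NumberTheory.EllipticCurves.AddSubgroup.torsionBy.coe_smul]
    exact (W.smul_geomOneRootOver_eq_iff hθ g).mpr (h θ)

/-! ### No non-zero `Γ_k`-fixed `2`-torsion point -/

omit [W.IsElliptic] in
/-- **`E(k)[2] = 0` in `E[2](k̄)`**: for `Ψ₂/4` irreducible over `k`, no non-zero point of `E[2]` is fixed by all
of `Γ_k` (Galois descent `E(k̄)^{Γ_k} = E(k)`, and a `k`-rational `2`-torsion point gives a `k`-root of `Ψ₂`).
[cite: SilvermanAEC2009, VIII.§1 and Prop. III.2.3] -/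
theorem exists_smul_ne_of_irreducible
    (hirr : Irreducible (X ^ 3 + C (W.b₂ / 4) * X ^ 2 + C (W.b₄ / 2) * X + C (W.b₆ / 4) : k[X]))
    (v : geomTorsion W 2) (hv : v ≠ 0) : ∃ g : absoluteGaloisGroup k, g • v ≠ v := by
  by_contra hcon
  push Not at hcon
  have hfix : (v : geomPoints W) ∈ MulAction.fixedPoints (absoluteGaloisGroup k) (geomPoints W) := by
    intro g
    have := congrArg (fun P : geomTorsion W 2 => (P : geomPoints W)) (hcon g)
    simpa only [Literature.NumberTheory.EllipticCurves.AddSubgroup.torsionBy.coe_smul] using this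
  rw [W.fixedPoints_eq_range_map_holds] at hfix
  obtain ⟨P, hP⟩ := hfix
  have hP' : Affine.Point.baseChange k (AlgebraicClosure k) P = (v : geomPoints W) := hP
  have h2v : (2 : ℤ) • (v : geomPoints W) = 0 := (mem_geomTorsion_iff W 2 _).mp v.2
  have h2P : (2 : ℕ) • P = 0 := by
    apply Affine.Point.map_injective (W' := W) (Algebra.ofId k (AlgebraicClosure k))
    rw [map_nsmul, map_zero]
    change (2 : ℕ) • (Affine.Point.baseChange k (AlgebraicClosure k) P : geomPoints W) = 0
    rw [hP', ← natCast_zsmul]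
    exact h2v
  rcases P with _ | ⟨x, y, hxy⟩
  · apply hv
    apply Subtype.ext
    change (v : geomPoints W) = 0
    rw [← hP']
    rfl
  · have hroot := (W.baseChange k).isRoot_Ψ₂Sq_of_two_nsmul_eq_zero hxy h2P
    have hb2 : (W.baseChange k).b₂ = W.b₂ := by rw [baseChange, map_b₂]; rfl
    have hb4 : (W.baseChange k).b₄ = W.b₄ := by rw [baseChange, map_b₄]; rfl
    have hb6 : (W.baseChange k).b₆ = W.b₆ := by rw [baseChange, map_b₆]; rfl
    rw [Ψ₂Sq, hb2, hb4, hb6, IsRoot.def] at hroot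
    simp only [eval_add, eval_mul, eval_C, eval_pow, eval_X] at hroot
    have hroot' : (X ^ 3 + C (W.b₂ / 4) * X ^ 2 + C (W.b₄ / 2) * X + C (W.b₆ / 4) : k[X]).IsRoot x := by
      rw [IsRoot.def]
      simp only [eval_add, eval_mul, eval_C, eval_pow, eval_X]
      linear_combination (1 / 4 : k) * hroot
    have hdeg := Polynomial.degree_eq_one_of_irreducible_of_root hirr hroot'
    have h3 := W.natDegree_twoDivision_monic
    rw [Polynomial.degree_eq_natDegree hirr.ne_zero, h3] at hdeg
    exact absurd hdeg (by decide)

/-! ### `E[2](k̄) = {O, T_θ, T₂, T₃}` -/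

/-- **`E[2](k̄) = {O, T_θ, T₂, T₃}` with `T_θ + T₂ = T₃`**, all distinct (over `k̄` the cubic splits with first
root `j(θ)`). [cite: SilvermanAEC2009, Cor. III.6.4 and Prop. X.1.4] -/
theorem exists_geomTwoTorsion_eq_over (hθ : (W.baseChange K).toAffine.IsTwoTorsionX θ) :
    ∃ T₂ T₃ : geomPoints W, T₂ ∈ geomTorsion W 2 ∧ T₃ ∈ geomTorsion W 2 ∧ T₂ ≠ 0 ∧ T₃ ≠ 0 ∧
      T₂ ≠ W.geomOneRootOver hθ ∧ T₃ ≠ W.geomOneRootOver hθ ∧ T₂ ≠ T₃ ∧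
      W.geomOneRootOver hθ + T₂ = T₃ ∧ T₂ + T₂ = 0 ∧
      ∀ P ∈ geomTorsion W 2, P = 0 ∨ P = W.geomOneRootOver hθ ∨ P = T₂ ∨ P = T₃ := by
  haveI := W.isElliptic_baseChange (AlgebraicClosure k)
  obtain ⟨e₂, e₃, hs⟩ := (W.isTwoTorsionX_algHom (closureCopy K) hθ).exists_splitTwoTorsion
  have hT : W.geomOneRootOver hθ = Affine.Point.some _ _ (Affine.nonsingular_twoTorsion hs) := rfl
  refine ⟨Affine.Point.some _ _ (Affine.nonsingular_twoTorsion hs.swap₁₂),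
    Affine.Point.some _ _ (Affine.nonsingular_twoTorsion hs.swap₂₃.swap₁₂), ?_, ?_,
    Affine.Point.some_ne_zero _, Affine.Point.some_ne_zero _, ?_, ?_, ?_, ?_, ?_, ?_⟩
  · rw [mem_geomTorsion_iff]; exact Affine.Point.two_zsmul_twoTorsion hs.swap₁₂
  · rw [mem_geomTorsion_iff]; exact Affine.Point.two_zsmul_twoTorsion hs.swap₂₃.swap₁₂
  · rw [hT]; intro heq
    exact hs.ne₁₂ (Affine.Point.some.inj heq).1.symm
  · rw [hT]; intro heq
    exact hs.ne₁₃ (Affine.Point.some.inj heq).1.symm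
  · intro heq
    exact hs.ne₂₃ (Affine.Point.some.inj heq).1
  · rw [hT]; exact Affine.Point.twoTorsion_add_twoTorsion hs
  · exact Affine.Point.twoTorsion_add_self hs.swap₁₂
  · intro P hP
    rw [mem_geomTorsion_iff] at hP
    have hP' : (2 : ℕ) • P = 0 := by rw [two_nsmul, ← two_zsmul]; exact hP
    rw [hT]
    exact Affine.Point.eq_zero_or_eq_twoTorsion_of_two_nsmul_eq_zero hs hP'

end WeierstrassCurve

end
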